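import Summits.Ventures.HSemireg.WedgeHankelRecurrenceGaussChebyshevTResultantClosed

/-!
# Venture HSemireg — **THE MIXED IDEAL `(T_m, U_{n−1})` OF `R[X]` FOR EVERY COMMUTATIVE RING: `= (T_{gcd(m,n)})` IF `n ∕ gcd(m,n)` IS EVEN, `= R[X]` IF IT IS ODD** — first- against
# second-kind Chebyshev polynomials (Gauss–Chebyshev nodes against Fejér ∕ Clenshaw–Curtis interior nodes): the product formulas `2 T_m U_k = U_{k+m} + U_{k−m}` (N438) and
# **`T_{k+j} − T_{k−j} = 2 (X² − 1) U_{j−1} U_{k−1}`** (typed here) give the two Euclidean steps `(U_{k+m}, T_m) = (U_{k−m}, T_m)` and `(T_{k+j}, U_{j−1}) = (T_{k−j}, U_{j−1})`, and a descent on `m + n`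
# folding alternately `n` modulo `2m` and `m` modulo `2n`; the invariant is `gcd(m,n)` together with the parity of `n ∕ gcd` (node reading: `T_m` and `U_{n−1}` share zeros iff `v₂(n) > v₂(m)`,
# and then the shared zeros are exactly those of `T_{gcd(m,n)}`)

HONEST FRAMING. Part of the Lean index of the computation cell `pub-hsemireg` (seat p10 gen 48, Sunday typer «UNIFORM-IN-n»).  Polynomial ∕ ideal algebra and `ℕ`-parity bookkeeping only; no
variety, no cohomology theory, no sheaf, no Ext group and no semiregularity map is constructed here; nothing here says that HC / HC_CM / HC_AV holds; no Literature fact (unproved `Prop`) is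
declared or used.  Custodian versions as in `WedgeHankelSiegelIdeal` (1/3).
SOURCES (cited).  M. O. Rayes, V. Trevisan, P. S. Wang, *Factorization properties of Chebyshev polynomials*, Comput. Math. Appl. 50 (2005) 1231–1240, §4 (gcds of `T_m`, `U_n`); J. C. Mason,
D. C. Handscomb, *Chebyshev Polynomials* (2003), §1.2 (product formulas); T. J. Rivlin, *Chebyshev Polynomials* (1990), §1.2.  The dichotomy was checked against exact resultants for `1 ≤ m ≤ 7`,
`1 ≤ n ≤ 8` (seat folder `work/py/mixed.py`).
PROOF TYPED HERE.  N438 `chebyshevT_mul_U`; N446 `chebyshev_isCoprime_T_U_pred`; N458 `exists_fold_mod_two_mul`, `gcd_eq_and_odd_div_iff_of_eq_add ∕ _of_add_eq`; N459 `span_pair_eq_top_iff_isCoprime`;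
Mathlib `two_mul_T_eq_U_sub_U`, `U_neg`, `U_neg_sub_one`, `T_neg`, `T_add_two`, `T_eq_X_mul_T_sub_pol_U`, `U_add_two ∕ U_sub_one`, `Ideal.span_pair_add_mul_right ∕ _add_right_mul`, `Ideal.span_insert_neg`,
`Ideal.span_pair_zero`, `Nat.strong_induction_on`, `Int.induction_on`.
DEDUP DISCLOSURE (`rg -n 'chebyshevT_add_sub_T_sub|chebyshevTU_span_pair|chebyshevTU_span_pair_dichotomy' Summits Literature HarnessLib`, 2026-09-04): N432 ∕ N440 (mixed resultants
for consecutive ∕ two-apart indices), N446 (`(T_n, U_{n−1}) = (1)`); `Literature…ChebyshevExplicitForms.U_add_eq_U_mul_T_add_T_mul_U` is a different mixed addition formula; N438 `chebyshevT_mul_U` is IMPORTED (not re-proved); 0 hits for the 9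
names below.

WHAT IS IN THE TREE.  N432, N438 `chebyshevT_mul_U`, N440, N446, N453, N457–N459.
THIS FILE (namespace `Summit.Ventures.HSemireg.Wedge.HankelOuter` continued; CHAINED on N461; 0 definitions):
* §1227 **`chebyshevT_add_sub_T_sub`** (`T_{k+j} − T_{k−j} = 2(X²−1) U_{j−1} U_{k−1}`), `chebyshevTU_span_pair_U_add`,
  `chebyshevTU_span_pair_U_add_mul`, `chebyshevTU_span_pair_U_neg`, `chebyshevTU_span_pair_T_add`, `chebyshevTU_span_pair_T_add_mul`, **`chebyshevTU_span_pair_dichotomy`**,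
  **`chebyshevTU_span_pair_eq_span_gcd`**, **`chebyshevTU_span_pair_eq_top`**.
CAVEATS.  `U_{n−1}` with `n ∈ ℕ` (`U_{−1} = 0`); `ℕ`-division conventions as in N458.  Nothing Ext-side.  New names only.
-/

open Module Polynomial
open scoped Matrix Polynomial

namespace Summit.Ventures.HSemireg.Wedge.HankelOuter

/-! ## §1227. The mixed ideal `(T_m, U_{n−1})` -/

/-- **`T_{k+j} − T_{k−j} = 2 (X² − 1) U_{j−1} U_{k−1}`** (all `j, k ∈ ℤ`, any commutative ring; «`−2 sin jθ sin kθ = cos (k+j)θ − cos (k−j)θ`»). [Mason–Handscomb §1.2; this file, §1227] -/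
theorem chebyshevT_add_sub_T_sub {R : Type*} [CommRing R] (j k : ℤ) :
    Polynomial.Chebyshev.T R (k + j) - Polynomial.Chebyshev.T R (k - j) =
      2 * (Polynomial.X ^ 2 - 1) * Polynomial.Chebyshev.U R (j - 1) * Polynomial.Chebyshev.U R (k - 1) := by
  induction j using Polynomial.Chebyshev.induct with
  | zero => simp only [add_zero, sub_zero, sub_self, zero_sub, Polynomial.Chebyshev.U_neg_one, mul_zero, zero_mul]
  | one =>
    have h1 := Polynomial.Chebyshev.T_eq_X_mul_T_sub_pol_U R (k - 1)
    have h2 := Polynomial.Chebyshev.T_add_two R (k - 1)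
    have hU0 := Polynomial.Chebyshev.U_zero R
    linear_combination (norm := ring_nf) 2 * h1 - h2 - 2 * (X ^ 2 - 1 : R[X]) * Polynomial.Chebyshev.U R (k - 1) * hU0
  | add_two j ih1 ih2 =>
    have h1 := Polynomial.Chebyshev.T_add_two R (k + j)
    have h2 := Polynomial.Chebyshev.T_sub_two R (k - j)
    have h3 := Polynomial.Chebyshev.U_add_two R ((j : ℤ) - 1)
    linear_combination (norm := ring_nf) h1 - h2 + 2 * (X : R[X]) * ih1 - ih2 - 2 * (X ^ 2 - 1 : R[X]) * Polynomial.Chebyshev.U R (k - 1) * h3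
  | neg_add_one j ih1 ih2 =>
    have h1 := Polynomial.Chebyshev.T_add_two R (k + (-(j : ℤ)) - 1)
    have h2 := Polynomial.Chebyshev.T_add_two R (k - (-(j : ℤ)) - 1)
    have h3 := Polynomial.Chebyshev.U_sub_one R (-(j : ℤ) - 1)
    linear_combination (norm := ring_nf) h1 - h2 + 2 * (X : R[X]) * ih1 - ih2 - 2 * (X ^ 2 - 1 : R[X]) * Polynomial.Chebyshev.U R (k - 1) * h3

/-- **Euclidean step `(U_{k+m}, T_m) = (U_{k−m}, T_m)`** (all `k, m ∈ ℤ`, any commutative ring). [this file, §1227] -/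
theorem chebyshevTU_span_pair_U_add {R : Type*} [CommRing R] (k m : ℤ) :
    Ideal.span {Polynomial.Chebyshev.U R (k + m), Polynomial.Chebyshev.T R m} = Ideal.span {Polynomial.Chebyshev.U R (k - m), Polynomial.Chebyshev.T R m} := by
  have h : Polynomial.Chebyshev.U R (k + m) = -Polynomial.Chebyshev.U R (k - m) + (2 * Polynomial.Chebyshev.U R k) * Polynomial.Chebyshev.T R m := by
    linear_combination (-1 : R[X]) * chebyshevT_mul_U (R := R) m k
  rw [h, Ideal.span_pair_add_mul_right, Ideal.span_insert_neg]

/-- `(U_{k + t·2m}, T_m) = (U_k, T_m)` for every `t ∈ ℤ`. [this file, §1227] -/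
theorem chebyshevTU_span_pair_U_add_mul {R : Type*} [CommRing R] (k m t : ℤ) :
    Ideal.span {Polynomial.Chebyshev.U R (k + t * (2 * m)), Polynomial.Chebyshev.T R m} = Ideal.span {Polynomial.Chebyshev.U R k, Polynomial.Chebyshev.T R m} := by
  have step : ∀ k' : ℤ, Ideal.span {Polynomial.Chebyshev.U R (k' + 2 * m), Polynomial.Chebyshev.T R m} = Ideal.span {Polynomial.Chebyshev.U R k', Polynomial.Chebyshev.T R m} := fun k' => by
    rw [show k' + 2 * m = (k' + m) + m by ring, chebyshevTU_span_pair_U_add, add_sub_cancel_right]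
  induction t using Int.induction_on with
  | zero => rw [zero_mul, add_zero]
  | succ i ih => rw [add_mul, one_mul, ← add_assoc, step, ih]
  | pred i ih =>
    have h := step (k + (-(i : ℤ) - 1) * (2 * m))
    rw [show k + (-(i : ℤ) - 1) * (2 * m) + 2 * m = k + (-(i : ℤ)) * (2 * m) by ring, ih] at h
    exact h.symm

/-- Reflection `(U_{−n−1}, T_m) = (U_{n−1}, T_m)` (oddness `U_{−n−1} = −U_{n−1}`). [this file, §1227] -/
theorem chebyshevTU_span_pair_U_neg {R : Type*} [CommRing R] (n m : ℤ) :
    Ideal.span {Polynomial.Chebyshev.U R (-n - 1), Polynomial.Chebyshev.T R m} = Ideal.span {Polynomial.Chebyshev.U R (n - 1), Polynomial.Chebyshev.T R m} := by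
  rw [Polynomial.Chebyshev.U_neg_sub_one, Ideal.span_insert_neg]

/-- **Euclidean step `(T_{k+j}, U_{j−1}) = (T_{k−j}, U_{j−1})`** (all `k, j ∈ ℤ`, any commutative ring). [this file, §1227] -/
theorem chebyshevTU_span_pair_T_add {R : Type*} [CommRing R] (k j : ℤ) :
    Ideal.span {Polynomial.Chebyshev.T R (k + j), Polynomial.Chebyshev.U R (j - 1)} = Ideal.span {Polynomial.Chebyshev.T R (k - j), Polynomial.Chebyshev.U R (j - 1)} := by
  have h : Polynomial.Chebyshev.T R (k + j) = Polynomial.Chebyshev.T R (k - j) + Polynomial.Chebyshev.U R (j - 1) * (2 * (Polynomial.X ^ 2 - 1) * Polynomial.Chebyshev.U R (k - 1)) := by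
    linear_combination chebyshevT_add_sub_T_sub (R := R) j k
  rw [h, Ideal.span_pair_add_right_mul]

/-- `(T_{k + t·2j}, U_{j−1}) = (T_k, U_{j−1})` for every `t ∈ ℤ`. [this file, §1227] -/
theorem chebyshevTU_span_pair_T_add_mul {R : Type*} [CommRing R] (k j t : ℤ) :
    Ideal.span {Polynomial.Chebyshev.T R (k + t * (2 * j)), Polynomial.Chebyshev.U R (j - 1)} = Ideal.span {Polynomial.Chebyshev.T R k, Polynomial.Chebyshev.U R (j - 1)} := by
  have step : ∀ k' : ℤ, Ideal.span {Polynomial.Chebyshev.T R (k' + 2 * j), Polynomial.Chebyshev.U R (j - 1)} = Ideal.span {Polynomial.Chebyshev.T R k', Polynomial.Chebyshev.U R (j - 1)} := fun k' => by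
    rw [show k' + 2 * j = (k' + j) + j by ring, chebyshevTU_span_pair_T_add, add_sub_cancel_right]
  induction t using Int.induction_on with
  | zero => rw [zero_mul, add_zero]
  | succ i ih => rw [add_mul, one_mul, ← add_assoc, step, ih]
  | pred i ih =>
    have h := step (k + (-(i : ℤ) - 1) * (2 * j))
    rw [show k + (-(i : ℤ) - 1) * (2 * j) + 2 * j = k + (-(i : ℤ)) * (2 * j) by ring, ih] at h
    exact h.symm

/-- **Dichotomy for the mixed ideal `(T_m, U_{n−1})` (any commutative ring): `= (T_{gcd(m,n)})` if `n ∕ gcd(m,n)` is even, `= R[X]` otherwise.** [Rayes–Trevisan–Wang 2005 §4, ideal form;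
this file, §1227] -/
theorem chebyshevTU_span_pair_dichotomy {R : Type*} [CommRing R] (m n : ℕ) :
    (Even (n / Nat.gcd m n) →
        Ideal.span {Polynomial.Chebyshev.T R (m : ℤ), Polynomial.Chebyshev.U R ((n : ℤ) - 1)} = Ideal.span {Polynomial.Chebyshev.T R (Nat.gcd m n : ℤ)}) ∧
      (¬ Even (n / Nat.gcd m n) →
        Ideal.span {Polynomial.Chebyshev.T R (m : ℤ), Polynomial.Chebyshev.U R ((n : ℤ) - 1)} = ⊤) := by
  obtain ⟨s, hs⟩ : ∃ s, m + n = s := ⟨_, rfl⟩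
  induction s using Nat.strong_induction_on generalizing m n with
  | _ s ih =>
  rcases Nat.eq_zero_or_pos n with rfl | hn
  · -- `U_{−1} = 0`
    refine ⟨fun _ => ?_, fun h => absurd (by rw [Nat.zero_div]; exact Even.zero) h⟩
    rw [Nat.cast_zero, zero_sub, Polynomial.Chebyshev.U_neg_one, Ideal.span_pair_zero, Nat.gcd_zero_right]
  rcases Nat.eq_zero_or_pos m with rfl | hm
  · -- `T_0 = 1`
    rw [Nat.gcd_zero_left, Nat.div_self hn]
    refine ⟨fun h => absurd h Nat.not_even_one, fun _ => ?_⟩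
    rw [Nat.cast_zero, Polynomial.Chebyshev.T_zero]
    exact Ideal.eq_top_of_isUnit_mem _ (Ideal.subset_span (Set.mem_insert _ _)) isUnit_one
  rcases lt_trichotomy m n with hlt | rfl | hgt
  · -- `m < n`: fold `n` modulo `2m`
    obtain ⟨j, hjm, q, hj⟩ := exists_fold_mod_two_mul hm n
    have hred : Ideal.span {Polynomial.Chebyshev.T R (m : ℤ), Polynomial.Chebyshev.U R ((n : ℤ) - 1)} =
        Ideal.span {Polynomial.Chebyshev.T R (m : ℤ), Polynomial.Chebyshev.U R ((j : ℤ) - 1)} ∧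
        Nat.gcd m n = Nat.gcd m j ∧ (Odd (n / Nat.gcd m j) ↔ Odd (j / Nat.gcd m j)) := by
      rcases hj with hj | hj
      · refine ⟨?_, gcd_eq_and_odd_div_iff_of_eq_add hj⟩
        rw [Ideal.span_pair_comm, hj, show (((j + 2 * m * q : ℕ)) : ℤ) - 1 = ((j : ℤ) - 1) + (q : ℤ) * (2 * m) by push_cast; ring,
          chebyshevTU_span_pair_U_add_mul, Ideal.span_pair_comm]
      · refine ⟨?_, gcd_eq_and_odd_div_iff_of_add_eq hj⟩
        have hz : (n : ℤ) - 1 = (-(j : ℤ) - 1) + (q : ℤ) * (2 * m) := by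
          have e := congrArg (Nat.cast : ℕ → ℤ) hj
          push_cast at e
          linarith
        rw [Ideal.span_pair_comm, hz, chebyshevTU_span_pair_U_add_mul, chebyshevTU_span_pair_U_neg, Ideal.span_pair_comm]
    obtain ⟨hideal, hg1, hg2⟩ := hred
    have h := ih (m + j) (by omega) m j rfl
    rw [hideal, hg1, ← Nat.not_odd_iff_even, hg2, Nat.not_odd_iff_even]
    exact h
  · -- `m = n ≥ 1`: `(T_m, U_{m−1}) = (1)`
    rw [Nat.gcd_self, Nat.div_self hm]
    refine ⟨fun h => absurd h Nat.not_even_one, fun _ => ?_⟩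
    exact (span_pair_eq_top_iff_isCoprime _ _).2 (chebyshev_isCoprime_T_U_pred (R := R) (m : ℤ))
  · -- `m > n`: fold `m` modulo `2n`
    obtain ⟨i, hin, q, hi⟩ := exists_fold_mod_two_mul hn m
    have hred : Ideal.span {Polynomial.Chebyshev.T R (m : ℤ), Polynomial.Chebyshev.U R ((n : ℤ) - 1)} =
        Ideal.span {Polynomial.Chebyshev.T R (i : ℤ), Polynomial.Chebyshev.U R ((n : ℤ) - 1)} ∧ Nat.gcd m n = Nat.gcd i n := by
      rcases hi with hi | hi
      · refine ⟨?_, by rw [Nat.gcd_comm, (gcd_eq_and_odd_div_iff_of_eq_add hi).1, Nat.gcd_comm]⟩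
        rw [hi, show (((i + 2 * n * q : ℕ)) : ℤ) = (i : ℤ) + (q : ℤ) * (2 * n) by push_cast; ring, chebyshevTU_span_pair_T_add_mul]
      · refine ⟨?_, by rw [Nat.gcd_comm, (gcd_eq_and_odd_div_iff_of_add_eq hi).1, Nat.gcd_comm]⟩
        have hz : (m : ℤ) = -(i : ℤ) + (q : ℤ) * (2 * n) := by
          have e := congrArg (Nat.cast : ℕ → ℤ) hi
          push_cast at e
          linarith
        rw [hz, chebyshevTU_span_pair_T_add_mul, Polynomial.Chebyshev.T_neg]
    obtain ⟨hideal, hg1⟩ := hred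
    have h := ih (i + n) (by omega) i n rfl
    rw [hideal, hg1]
    exact h

/-- **`(T_m, U_{n−1}) = (T_{gcd(m,n)})` when `n ∕ gcd(m,n)` is even** (any commutative ring). [Rayes–Trevisan–Wang 2005 §4; this file, §1227] -/
theorem chebyshevTU_span_pair_eq_span_gcd {R : Type*} [CommRing R] {m n : ℕ} (h : Even (n / Nat.gcd m n)) :
    Ideal.span {Polynomial.Chebyshev.T R (m : ℤ), Polynomial.Chebyshev.U R ((n : ℤ) - 1)} = Ideal.span {Polynomial.Chebyshev.T R (Nat.gcd m n : ℤ)} :=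
  (chebyshevTU_span_pair_dichotomy m n).1 h

/-- **`(T_m, U_{n−1}) = R[X]` (so `T_m`, `U_{n−1}` are coprime) when `n ∕ gcd(m,n)` is odd** (any commutative ring). [Rayes–Trevisan–Wang 2005 §4; this file, §1227] -/
theorem chebyshevTU_span_pair_eq_top {R : Type*} [CommRing R] {m n : ℕ} (h : ¬ Even (n / Nat.gcd m n)) :
    Ideal.span {Polynomial.Chebyshev.T R (m : ℤ), Polynomial.Chebyshev.U R ((n : ℤ) - 1)} = ⊤ :=
  (chebyshevTU_span_pair_dichotomy m n).2 h

end Summit.Ventures.HSemireg.Wedge.HankelOuter
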